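import Summits.QuantumFields.BalabanUV.T4Continuum.Support.GradedSubBlocksPoincare
import Summits.QuantumFields.BalabanUV.T4Continuum.Support.ScalarBlockTrialFunction

/-!
# T⁴ programme, spine node NE2 (U1a), sub-row Δ1 — graded well, crew socket (GW-K), file T:
# SMOOTH TRIAL FUNCTIONS ("tents") ON THE SCALE-`s` SUB-BLOCKS OF A TORUS

NE2 formalisation swarm, leaf-05 (gen 10), for the owner's socket (GW-K) of RULING R48 (journal 2026-08-21): the LEVEL-FREE
bound `‖(Q′ₙG′²Q′ₙᴴ)⁻¹‖ ≤ ki` for the graded scalar data needs, exactly as [B8] (3.48) «Q′G′Q′* ≥ σ₀» does at unit scale, a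
trial function per averaging row whose ENERGY is `O((c/s)²)` per unit mass — the piecewise-constant trial `meanSᴴ` costs `c²/s`
per unit mass (one fine bond carries the whole jump), which is not level-free on the fine layers of the graded well.  This file
builds the scale-`s` analogue of `ScalarBlockTrialFunction.trial` on the owner's anchor API (`GradedSubBlocks`: `Anc`, `site`,
`meanS`, `shiftAnc`; `GradedSubBlocksRefine.anchorOf`): the separable tent `bumpW s` of leaf-09/gan24 planted in every sub-block.

 * §1 `digS` (the offset digits `y_ν mod s`), **`tentS N s g y := g (anchorOf y) · bumpW s (digS y)`**, `tentS_site`;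
 * §2 **`meanS_tentS : meanS *ᵥ tentS g = β₁(s)^d • g`** (`β₁ ≥ 1/6`), `nsq_tentS_le : nsq (tentS g) ≤ s^d·nsq g`;
 * §3 stepping across sites (`site_step_lt` inside a sub-block, `site_step_eq` across a face to `shiftAnc ν z`), the pointwise bound
   `norm_tentS_step_le : ‖tent(y + e_ν) − tent(y)‖ ≤ (‖g z‖ + ‖g (z + s e_ν)‖)/s`, and the energy bound
   **`nsq_sdiff_tentS_le : nsq (sdiff N c ν *ᵥ tentS g) ≤ ‖c‖²·(4 s^d/s²)·nsq g`**.

With amplitudes `g = s^{−d/2}·c` (unit mass per row) the energy is `4‖c‖²(c_lat/s)²` per direction: at level `k` of the graded well,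
`c_lat = L^k`, `s = s_i = L^{k−i}`, so `(c_lat/s)² = L^{2i} ≤ L^{2m}` — level-free (file `GradedWellGram`).

HONEST FRAMING (T4-DAG p. 1).  [folklore] finite lattice calculus; no estimate of print; the `[cite:]` tag on `tentS` locates the SHAPE
of (3.48)'s trial functions only.  NE2 (U1a) NOT proved; spine PROVED 0/9 unchanged; NOT [B9] (3.16)/(3.23)–(3.27) as printed; NOT
infinite volume / mass gap / Clay.  HONEST DEPENDENCY: continuum YM on T⁴ ⇐ BetaPertH ∧ nine spine estimates (0/9 proved);
BetaPertH ⇐ (D1) ∧ (D4) ∧ CAP+tail; G-an2-4 gates asym, D1 and NE2/3/4.  No `sorry`.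
-/

noncomputable section

open scoped BigOperators ComplexConjugate Matrix
open Finset

namespace Summit.QuantumFields.BalabanUV.T4Continuum.GradedSubBlockTents

open Literature.MathematicalPhysics.QuantumFieldTheory.Balaban1983to89.B5Prop11Plancherel (Tor unitVec)
open Literature.MathematicalPhysics.QuantumFieldTheory.Balaban1983to89.B5Prop11Lower (nsq nsq_nonneg)
open Literature.MathematicalPhysics.QuantumFieldTheory.Balaban1983to89.B5Block118 (tstep)
open Literature.MathematicalPhysics.QuantumFieldTheory.Balaban1983to89.B5Action121 (sdiff sdiff_mulVec)
open Summit.QuantumFields.BalabanUV.T4Continuum.ScalarBlockTrialFunction (bump bumpW beta1 bump_face abs_bump_step_le bumpW_mem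
  bumpW_update prod_erase_mem sum_bumpW_eq)
open Summit.QuantumFields.BalabanUV.T4Continuum.GradedSubBlocks (Anchor Anc InSub site meanS shiftAnc s_pos val_site inSub_site
  meanS_mulVec)
open Summit.QuantumFields.BalabanUV.T4Continuum.GradedSubBlocksRefine (anchorOf eq_anchorOf_of_inSub)
open Summit.QuantumFields.BalabanUV.T4Continuum.GradedSubBlocksPoincare (sum_sites_eq card_offsets)

variable {d : ℕ} (N : Fin d → ℕ) [hN : ∀ ν, NeZero (N ν)] (s : ℕ) [NeZero s]

/-! ## §1 Offset digits and the tent -/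

/-- the OFFSET DIGITS of a site: `(y_ν mod s)_ν ∈ [0,s)^d` (for `y = z + j` in the sub-block of the anchor `z`: `j`). [folklore] -/
def digS (y : Tor N) : Fin d → Fin s := fun ν => ⟨(y ν).val % s, Nat.mod_lt _ (s_pos s)⟩

omit [NeZero s] in
/-- `digS (z + j) = j` for an anchor `z`. [folklore] -/
theorem digS_site [NeZero s] (hs : ∀ ν, s ∣ N ν) {z : Tor N} (hz : Anchor N s z) (j : Fin d → Fin s) :
    digS N s (site N s z j) = j := by
  funext ν
  apply Fin.ext
  show (site N s z j ν).val % s = (j ν : ℕ)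
  rw [val_site N s hs hz j ν]
  obtain ⟨q, hq⟩ := hz ν
  rw [hq, Nat.add_comm, Nat.add_mul_mod_self_left, Nat.mod_eq_of_lt (j ν).isLt]

/-- `anchorOf (z + j) = z`. [folklore] -/
theorem anchorOf_site (hs : ∀ ν, s ∣ N ν) (z : Anc N s) (j : Fin d → Fin s) :
    anchorOf N s (site N s z.1 j) = z :=
  (eq_anchorOf_of_inSub N s (inSub_site N s hs z.2 j)).symm

/-- **THE SCALE-`s` TENT** with amplitudes `g`: `ψ_g(y) = g(anchor of y)·W_s(digits of y)`, `W_s(j) = Π_ν b_s(j_ν)`,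
`b_s(t) = (t+1)(s−t)/s²` — the trial functions of (3.48) planted in every scale-`s` sub-block.
[cite: Balaban1985BackgroundPropagators, (3.48) p.398 (shape: the trial functions behind «Q′G′Q′* ≥ σ₀»)] [folklore] -/
def tentS (g : Anc N s → ℂ) : Tor N → ℂ := fun y => g (anchorOf N s y) * ((bumpW s (digS N s y) : ℝ) : ℂ)

/-- unfolding. [folklore] -/
theorem tentS_apply (g : Anc N s → ℂ) (y : Tor N) :
    tentS N s g y = g (anchorOf N s y) * ((bumpW s (digS N s y) : ℝ) : ℂ) := rfl

/-- `ψ_g(z + j) = g(z)·W_s(j)`. [folklore] -/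
theorem tentS_site (hs : ∀ ν, s ∣ N ν) (g : Anc N s → ℂ) (z : Anc N s) (j : Fin d → Fin s) :
    tentS N s g (site N s z.1 j) = g z * ((bumpW s j : ℝ) : ℂ) := by
  rw [tentS_apply, anchorOf_site N s hs z j, digS_site N s hs z.2 j]

/-! ## §2 Means and mass of a tent -/

/-- **the sub-block means of a tent**: `meanS *ᵥ ψ_g = β₁(s)^d • g` (`β₁(s) = (s+1)(s+2)/(6s²) ≥ 1/6`). [folklore] -/
theorem meanS_tentS (hs : ∀ ν, s ∣ N ν) (g : Anc N s → ℂ) :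
    meanS N s *ᵥ tentS N s g = (((beta1 s) ^ d : ℝ) : ℂ) • g := by
  funext z
  rw [meanS_mulVec N s hs z, Pi.smul_apply, smul_eq_mul]
  simp_rw [tentS_site N s hs g z]
  rw [← Finset.mul_sum]
  have h1 : ∑ j : Fin d → Fin s, ((bumpW s j : ℝ) : ℂ) = ((((s : ℝ) * beta1 s) ^ d : ℝ) : ℂ) := by
    rw [← sum_bumpW_eq s]; push_cast; rfl
  rw [h1]
  have hs0 : (s : ℂ) ≠ 0 := by exact_mod_cast NeZero.ne s
  push_cast
  rw [mul_pow]
  field_simp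

/-- the mass of a tent: `nsq ψ_g ≤ s^d·nsq g` (`0 ≤ W_s ≤ 1`). [folklore] -/
theorem nsq_tentS_le (hs : ∀ ν, s ∣ N ν) (g : Anc N s → ℂ) : nsq (tentS N s g) ≤ (s : ℝ) ^ d * nsq g := by
  unfold nsq
  rw [sum_sites_eq N s hs (fun y => ‖tentS N s g y‖ ^ 2), Finset.mul_sum]
  refine Finset.sum_le_sum fun z _ => ?_
  simp_rw [tentS_site N s hs g z]
  calc ∑ j : Fin d → Fin s, ‖g z * ((bumpW s j : ℝ) : ℂ)‖ ^ 2 ≤ ∑ _j : Fin d → Fin s, ‖g z‖ ^ 2 :=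
        Finset.sum_le_sum fun j _ => by
          rw [norm_mul, mul_pow, Complex.norm_real, Real.norm_eq_abs, abs_of_nonneg (bumpW_mem s j).1]
          exact mul_le_of_le_one_right (sq_nonneg _) (by nlinarith [(bumpW_mem s j).1, (bumpW_mem s j).2])
    _ = (s : ℝ) ^ d * ‖g z‖ ^ 2 := by rw [Finset.sum_const, Finset.card_univ, nsmul_eq_mul, card_offsets]

/-! ## §3 Stepping and the energy of a tent -/

omit hN [NeZero s] in
/-- stepping INSIDE a sub-block: `(z + j) + e_ν = z + j′`, `j′ = j + e_ν`, when `j_ν + 1 < s`. [folklore] -/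
theorem site_step_lt (z : Tor N) (j : Fin d → Fin s) (ν : Fin d) (h : (j ν : ℕ) + 1 < s) :
    site N s z j + unitVec N ν = site N s z (Function.update j ν ⟨(j ν : ℕ) + 1, h⟩) := by
  funext μ
  simp only [Pi.add_apply, site, unitVec]
  by_cases hμ : μ = ν
  · subst hμ
    simp only [Function.update_self, Fin.val_mk, Pi.single_eq_same]
    push_cast
    ring
  · simp only [Function.update_of_ne hμ, Pi.single_eq_of_ne hμ, add_zero]

omit hN [NeZero s] in
/-- stepping ACROSS a face: `(z + j) + e_ν = (z + s e_ν) + j⁰`, `j⁰ = j − j_ν e_ν`, when `j_ν + 1 = s`. [folklore] -/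
theorem site_step_eq (z : Tor N) (j : Fin d → Fin s) (ν : Fin d) (h : (j ν : ℕ) + 1 = s) :
    site N s z j + unitVec N ν = site N s (z + tstep N ν s) (Function.update j ν ⟨0, by omega⟩) := by
  funext μ
  simp only [Pi.add_apply, site, unitVec, tstep]
  by_cases hμ : μ = ν
  · subst hμ
    simp only [if_true, Function.update_self, Fin.val_mk, Pi.single_eq_same]
    have e : ((j μ : ℕ) : ZMod (N μ)) + 1 = ((s : ℕ) : ZMod (N μ)) := by
      have e' := congrArg (Nat.cast : ℕ → ZMod (N μ)) h
      push_cast at e'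
      exact e'
    rw [← e]
    push_cast
    ring
  · simp only [if_neg hμ, Function.update_of_ne hμ, Pi.single_eq_of_ne hμ, add_zero]

/-- **pointwise step bound**: `‖ψ_g(y + e_ν) − ψ_g(y)‖ ≤ (‖g z‖ + ‖g (z + s e_ν)‖)/s` for `y` in the sub-block of `z`
(inside: `|b_s(t+1) − b_s(t)| ≤ 1/s`; across the face: both tents equal `(1/s)·Π` there). [folklore] -/
theorem norm_tentS_step_le (hs : ∀ ν, s ∣ N ν) (g : Anc N s → ℂ) (z : Anc N s) (j : Fin d → Fin s) (ν : Fin d) :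
    ‖tentS N s g (site N s z.1 j + unitVec N ν) - tentS N s g (site N s z.1 j)‖
      ≤ (‖g z‖ + ‖g (shiftAnc N s hs ν z)‖) / s := by
  have hs0 : (0 : ℝ) < s := by exact_mod_cast s_pos s
  have hP := prod_erase_mem s j ν
  rcases Nat.lt_or_ge ((j ν : ℕ) + 1) s with hlt | hge
  · rw [site_step_lt N s z.1 j ν hlt, tentS_site N s hs g z, tentS_site N s hs g z, ← mul_sub, norm_mul,
      ← Complex.ofReal_sub, Complex.norm_real, Real.norm_eq_abs]
    have hb : |bumpW s (Function.update j ν ⟨(j ν : ℕ) + 1, hlt⟩) - bumpW s j| ≤ 1 / s := by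
      rw [(bumpW_update s j ν ⟨_, hlt⟩).1, (bumpW_update s j ν ⟨_, hlt⟩).2, ← sub_mul, abs_mul, abs_of_nonneg hP.1]
      have h1 := abs_bump_step_le s (j ν) hlt
      rw [abs_mul, abs_of_pos hs0] at h1
      have h2 : |bump s ((j ν : ℕ) + 1) - bump s (j ν)| ≤ 1 / s := by
        rw [le_div_iff₀ hs0, mul_comm]; exact h1
      calc |bump s ((j ν : ℕ) + 1) - bump s (j ν)| * ∏ μ ∈ univ.erase ν, bump s (j μ) ≤ 1 / s * 1 :=
            mul_le_mul h2 hP.2 hP.1 (by positivity)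
        _ = 1 / s := mul_one _
    calc ‖g z‖ * |bumpW s (Function.update j ν ⟨(j ν : ℕ) + 1, hlt⟩) - bumpW s j| ≤ ‖g z‖ * (1 / s) :=
          mul_le_mul_of_nonneg_left hb (norm_nonneg _)
      _ ≤ (‖g z‖ + ‖g (shiftAnc N s hs ν z)‖) / s := by
          rw [mul_one_div]
          exact div_le_div_of_nonneg_right (le_add_of_nonneg_right (norm_nonneg _)) hs0.le
  · have heq : (j ν : ℕ) + 1 = s := le_antisymm (j ν).isLt hge
    rw [site_step_eq N s z.1 j ν heq]
    show ‖tentS N s g (site N s (shiftAnc N s hs ν z).1 _) - _‖ ≤ _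
    rw [tentS_site N s hs g (shiftAnc N s hs ν z), tentS_site N s hs g z,
      (bumpW_update s j ν ⟨0, by omega⟩).1, (bumpW_update s j ν ⟨0, by omega⟩).2]
    have hf := bump_face s (j ν) heq
    rw [hf.1, hf.2, ← sub_mul, norm_mul, Complex.norm_real, Real.norm_eq_abs,
      abs_of_nonneg (mul_nonneg (by positivity) hP.1)]
    calc ‖g (shiftAnc N s hs ν z) - g z‖ * (1 / s * ∏ μ ∈ univ.erase ν, bump s (j μ))
        ≤ (‖g (shiftAnc N s hs ν z)‖ + ‖g z‖) * (1 / s * 1) :=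
          mul_le_mul (norm_sub_le _ _) (mul_le_mul_of_nonneg_left hP.2 (by positivity))
            (mul_nonneg (by positivity) hP.1) (by positivity)
      _ = (‖g z‖ + ‖g (shiftAnc N s hs ν z)‖) / s := by ring

omit [NeZero s] in
/-- the anchor shift `z ↦ z + s e_ν` is injective (hence a bijection of the finite anchor type). [folklore] -/
theorem shiftAnc_injective (hs : ∀ ν, s ∣ N ν) (ν : Fin d) : Function.Injective (shiftAnc N s hs ν) := by
  intro z w h
  apply Subtype.ext
  have h1 := congrArg Subtype.val h
  exact add_right_cancel h1

/-- **THE ENERGY OF A TENT**: `nsq (sdiff N c ν *ᵥ ψ_g) ≤ ‖c‖²·(4 s^d/s²)·nsq g` — `O((c/s)²)` per unit mass `s^{−d}`. [folklore] -/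
theorem nsq_sdiff_tentS_le (hs : ∀ ν, s ∣ N ν) (c : ℂ) (ν : Fin d) (g : Anc N s → ℂ) :
    nsq (sdiff N c ν *ᵥ tentS N s g) ≤ ‖c‖ ^ 2 * (4 * (s : ℝ) ^ d / (s : ℝ) ^ 2) * nsq g := by
  have hs0 : (0 : ℝ) < s := by exact_mod_cast s_pos s
  set z' := shiftAnc N s hs ν with hz'
  have e1 : nsq (sdiff N c ν *ᵥ tentS N s g) = ∑ z : Anc N s, ∑ j : Fin d → Fin s,
      ‖c‖ ^ 2 * ‖tentS N s g (site N s z.1 j + unitVec N ν) - tentS N s g (site N s z.1 j)‖ ^ 2 := by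
    unfold nsq
    rw [sum_sites_eq N s hs]
    refine Finset.sum_congr rfl fun z _ => Finset.sum_congr rfl fun j _ => ?_
    rw [sdiff_mulVec, norm_mul, mul_pow]
  rw [e1]
  have e2 : ∀ z : Anc N s, ∑ j : Fin d → Fin s,
      ‖c‖ ^ 2 * ‖tentS N s g (site N s z.1 j + unitVec N ν) - tentS N s g (site N s z.1 j)‖ ^ 2
        ≤ ‖c‖ ^ 2 * ((2 * (s : ℝ) ^ d / (s : ℝ) ^ 2) * (‖g z‖ ^ 2 + ‖g (z' z)‖ ^ 2)) := by
    intro z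
    rw [← Finset.mul_sum]
    refine mul_le_mul_of_nonneg_left ?_ (sq_nonneg _)
    calc ∑ j : Fin d → Fin s, ‖tentS N s g (site N s z.1 j + unitVec N ν) - tentS N s g (site N s z.1 j)‖ ^ 2
        ≤ ∑ _j : Fin d → Fin s, ((‖g z‖ + ‖g (z' z)‖) / s) ^ 2 :=
          Finset.sum_le_sum fun j _ => pow_le_pow_left₀ (norm_nonneg _) (norm_tentS_step_le N s hs g z j ν) 2
      _ = (s : ℝ) ^ d * ((‖g z‖ + ‖g (z' z)‖) / s) ^ 2 := by
          rw [Finset.sum_const, Finset.card_univ, nsmul_eq_mul, card_offsets]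
      _ ≤ (2 * (s : ℝ) ^ d / (s : ℝ) ^ 2) * (‖g z‖ ^ 2 + ‖g (z' z)‖ ^ 2) := by
          rw [div_pow, ← mul_div_assoc, div_mul_eq_mul_div, div_le_div_iff_of_pos_right (by positivity)]
          nlinarith [sq_nonneg (‖g z‖ - ‖g (z' z)‖), pow_nonneg hs0.le d]
  refine (Finset.sum_le_sum fun z _ => e2 z).trans ?_
  have e3 : ∑ z : Anc N s, ‖g (z' z)‖ ^ 2 = nsq g :=
    (Equiv.ofBijective z' (Finite.injective_iff_bijective.mp (shiftAnc_injective N s hs ν))).sum_comp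
      (fun w => ‖g w‖ ^ 2)
  have e4 : ∑ z : Anc N s, ‖g z‖ ^ 2 = nsq g := rfl
  rw [← Finset.mul_sum, ← Finset.mul_sum, Finset.sum_add_distrib, e3, e4]
  apply le_of_eq
  ring

end Summit.QuantumFields.BalabanUV.T4Continuum.GradedSubBlockTents

end
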